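import Literature.GroupTheory.CombinatorialGroupTheory.AmalgamEllipticConjugacy
import Literature.GroupTheory.CombinatorialGroupTheory.AmalgamConjugacyCriterion
import HarnessLib

/-!
# Minimal length is a conjugacy invariant in an amalgam (Dyer's Thm. 2 (1)(2), cyclically reduced form)

Topic `Literature/GroupTheory/CombinatorialGroupTheory`; theorems only, continuing
`AmalgamEllipticConjugacy.lean` (MKS Thm. 4.6 (i)(ii)) and `AmalgamConjugacyCriterion.lean`
(MKS Thm. 4.6 (iii), rotation form) — letter lists in Mathlib's `Monoid.PushoutI φ`; reduced =
alternating factors, no letter in the amalgamated subgroup; value `ℓπ[φ] l`; an element `y` is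
*cyclically reduced* when no reduced word of length `≥ 2` for it has both end letters in one factor
(spelled out as `∀ L, reduced L → ℓπ L = y → 2 ≤ L.length → L.head?.map Sigma.fst ≠
L.getLast?.map Sigma.fst`, as in `AmalgamConjugation.lean`).

* `exists_rotate_of_isConj_of_cr` — the rotation form of the conjugation theorem with an
  *arbitrary cyclically reduced partner*: if `ℓπ w` (`w` reduced of length `≥ 2` with end letters in
  different factors) is conjugate to a cyclically reduced `y`, then
  `y = (base c) · ℓπ (w.rotate k) · (base c)⁻¹`; hence `not_isConj_lprod_base`,
  `not_isConj_lprod_of` — **length `≥ 2` is never conjugate to length `≤ 1`** (Dyer (1): *"then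
  `‖y‖ ≤ 1`"*, (2): *"then `‖y‖ = 1`"*, (3): *"then `‖y‖ = ‖x‖`"*);
* `exists_eq_of_of_isConj_of_cr` — **Dyer's Thm. 2 (2)**: every cyclically reduced conjugate of a
  letter `g ∈ G i` not conjugate within `G i` into `φ i(H)` is a letter `of i g'` with `g' ~_{G i} g`;
* `exists_eq_of_of_isConj_base_of_cr` — **Dyer's Thm. 2 (1)**: every cyclically reduced conjugate of
  a base element lies in a factor, `y = of i g` with `g ~_{G i} φ i c'` and `c'` chained to `c`
  through the base group;
* `isConj_base_iff_of_malnormal`, `base_isConj_base_iff_eq_of_malnormal`,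
  `isConj_of_base_iff_of_malnormal` — when `φ i(H)` is **malnormal** in every factor the chains of
  MKS (i) collapse: base elements are conjugate in the amalgam iff they are conjugate in `H` (equal,
  for commutative `H` — e.g. `c ^ r ~ c ^ s ↔ r = s` in the surface amalgam `F_{2g} *_ℤ F_{2h}`).

## References

* J. L. Dyer, *Separating conjugates in amalgamated free products and HNN extensions*, J. Austral.
  Math. Soc. Ser. A 29 (1980) 35–51, Thm. 2 (1)(2)(3) p.37–38. [Dyer1980]
* W. Magnus, A. Karrass, D. Solitar, *Combinatorial Group Theory*, Interscience (1966), §4.2,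
  Thm. 4.6, Cor. 4.5. [MagnusKarrassSolitar1966]
-/

namespace Literature.GroupTheory.CombinatorialGroupTheory

namespace Amalgam

open Monoid Monoid.PushoutI

variable {ι : Type*} {G : ι → Type*} [∀ i, Group (G i)] {H : Type*} [Group H]
  {φ : ∀ i, H →* G i}

/-- The value in `PushoutI φ` of a letter list. -/
local notation3 "ℓπ[" φ "] " l:max =>
  List.prod (List.map (fun x => Monoid.PushoutI.of (φ := φ) (Sigma.fst x) (Sigma.snd x)) l)


/-! ### Length `≥ 2` versus length `≤ 1` -/

/-- Powers of `W` conjugate `W` to itself: `(D · W ^ q) · W · (D · W ^ q)⁻¹ = D · W · D⁻¹`.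
[cite: MagnusKarrassSolitar1966, §4.2 Thm. 4.6] -/
private theorem mul_zpow_conj_self' {M : Type*} [Group M] (D W : M) (q : ℤ) :
    D * W ^ q * W * (D * W ^ q)⁻¹ = D * W * D⁻¹ := by
  have h : W ^ q * W = W * W ^ q := by
    rw [← zpow_add_one, ← zpow_one_add, add_comm]
  calc D * W ^ q * W * (D * W ^ q)⁻¹ = D * (W ^ q * W) * (W ^ q)⁻¹ * D⁻¹ := by group
    _ = D * (W * W ^ q) * (W ^ q)⁻¹ * D⁻¹ := by rw [h]
    _ = D * W * D⁻¹ := by group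

/-- **Conjugation theorem, rotation form with an arbitrary cyclically reduced partner.**  Let `w`
be a reduced word of length `≥ 2` whose end letters lie in different factors.  If `ℓπ w` is
conjugate to a *cyclically reduced* element `y` (no reduced word of length `≥ 2` for `y` has both
end letters in one factor), then `y = (base c) · ℓπ (w.rotate k) · (base c)⁻¹` for some `c ∈ H`,
`k < |w|` — proof as for `exists_rotate_of_isConj`, from the centralizer form
`exists_eq_base_mul_drop_mul_zpow`. [cite: Dyer1980, Thm. 2 (3) p.38] -/
theorem exists_rotate_of_isConj_of_cr (hφ : ∀ i, Function.Injective (φ i))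
    {w : List (Σ i, G i)} (hwc : w.IsChain fun a b => a.1 ≠ b.1)
    (hwr : ∀ z ∈ w, z.2 ∉ (φ z.1).range) (hw2 : 2 ≤ w.length)
    (hwcr : ∀ a ∈ w.getLast?, ∀ b ∈ w.head?, a.1 ≠ b.1) {y : PushoutI φ}
    (hy : ∀ L : List (Σ i, G i), L.IsChain (fun a b => a.1 ≠ b.1) →
      (∀ x ∈ L, x.2 ∉ (φ x.1).range) → ℓπ[φ] L = y → 2 ≤ L.length →
      L.head?.map Sigma.fst ≠ L.getLast?.map Sigma.fst)
    (h : IsConj (ℓπ[φ] w) y) :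
    ∃ (c : H) (k : ℕ), k < w.length ∧ y = base φ c * ℓπ[φ] (w.rotate k) * (base φ c)⁻¹ := by
  obtain ⟨g, hg⟩ := isConj_iff.mp h
  obtain ⟨c₀, hl, hlc, hlr, rfl⟩ := exists_reduced_eq hφ g
  have hconj : ℓπ[φ] hl * ℓπ[φ] w * (ℓπ[φ] hl)⁻¹ =
      base φ c₀⁻¹ * y * (base φ c₀⁻¹)⁻¹ := by
    rw [← hg, map_inv, inv_inv]; group
  have hY := cr_base_conj hy c₀⁻¹
  rw [← hconj] at hY
  obtain ⟨c, k, q, hk, e⟩ :=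
    exists_eq_base_mul_drop_mul_zpow hl.length w hl hw2 hwc hwr hwcr rfl hlc hlr hY
  refine ⟨c₀ * c, k, hk, ?_⟩
  have e2 : ℓπ[φ] hl * ℓπ[φ] w * (ℓπ[φ] hl)⁻¹ =
      base φ c * ℓπ[φ] (w.rotate k) * (base φ c)⁻¹ := by
    have step : ℓπ[φ] hl * ℓπ[φ] w * (ℓπ[φ] hl)⁻¹ =
        base φ c * (ℓπ[φ] (w.drop k) * ℓπ[φ] w ^ q * ℓπ[φ] w *
          (ℓπ[φ] (w.drop k) * ℓπ[φ] w ^ q)⁻¹) * (base φ c)⁻¹ := by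
      rw [e]; group
    rw [step, mul_zpow_conj_self', lprod_drop_mul_lprod_mul_inv w hk.le]
  calc y = base φ c₀ * (ℓπ[φ] hl * ℓπ[φ] w * (ℓπ[φ] hl)⁻¹) * (base φ c₀)⁻¹ := by
        rw [← hg]; group
    _ = base φ (c₀ * c) * ℓπ[φ] (w.rotate k) * (base φ (c₀ * c))⁻¹ := by
        rw [e2, map_mul]; group

/-- **A cyclically reduced word of length `≥ 2` is not conjugate to a base element** (its
cyclically reduced conjugates all have length `|w| ≥ 2`; Dyer (1): *"if `‖x‖ = 0`, then
`‖y‖ ≤ 1`"*). [cite: Dyer1980, Thm. 2 (1) p.37–38] -/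
theorem not_isConj_lprod_base (hφ : ∀ i, Function.Injective (φ i))
    {w : List (Σ i, G i)} (hwc : w.IsChain fun a b => a.1 ≠ b.1)
    (hwr : ∀ z ∈ w, z.2 ∉ (φ z.1).range) (hw2 : 2 ≤ w.length)
    (hwcr : ∀ a ∈ w.getLast?, ∀ b ∈ w.head?, a.1 ≠ b.1) (c : H) :
    ¬ IsConj (ℓπ[φ] w) (base φ c) := by
  intro h
  have hy : ∀ L : List (Σ i, G i), L.IsChain (fun a b => a.1 ≠ b.1) →
      (∀ x ∈ L, x.2 ∉ (φ x.1).range) → ℓπ[φ] L = base φ c → 2 ≤ L.length →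
      L.head?.map Sigma.fst ≠ L.getLast?.map Sigma.fst := by
    intro L hLc hLr hval hL2
    have := eq_nil_of_lprod_mem_range hφ hLc hLr (hval ▸ ⟨c, rfl⟩)
    subst this
    simp at hL2
  obtain ⟨c', k, -, e⟩ := exists_rotate_of_isConj_of_cr hφ hwc hwr hw2 hwcr hy h
  have e' : ℓπ[φ] (w.rotate k) = base φ (c'⁻¹ * c * c') := by
    rw [map_mul, map_mul, map_inv, e]; group
  have hnil := eq_nil_of_lprod_mem_range hφ (isChain_rotate hwc hwcr k)
    (fun z hz => hwr z (List.mem_rotate.mp hz)) (e' ▸ ⟨_, rfl⟩)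
  have : w.length = 0 := by rw [← List.length_rotate w k, hnil, List.length_nil]
  omega

/-- **A cyclically reduced word of length `≥ 2` is not conjugate to a single letter** (Dyer (2):
*"if `‖x‖ = 1`, then `‖y‖ = 1`"*; with (3): conjugate cyclically reduced elements have the same
length). [cite: Dyer1980, Thm. 2 (2) p.38] -/
theorem not_isConj_lprod_of (hφ : ∀ i, Function.Injective (φ i))
    {w : List (Σ i, G i)} (hwc : w.IsChain fun a b => a.1 ≠ b.1)
    (hwr : ∀ z ∈ w, z.2 ∉ (φ z.1).range) (hw2 : 2 ≤ w.length)
    (hwcr : ∀ a ∈ w.getLast?, ∀ b ∈ w.head?, a.1 ≠ b.1) {i : ι} (g : G i) :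
    ¬ IsConj (ℓπ[φ] w) (of i g) := by
  by_cases hg : g ∈ (φ i).range
  · obtain ⟨c, rfl⟩ := hg
    rw [of_apply_eq_base]
    exact not_isConj_lprod_base hφ hwc hwr hw2 hwcr c
  intro h
  have hsc : ([Sigma.mk i g] : List (Σ i, G i)).IsChain (fun a b => a.1 ≠ b.1) :=
    List.IsChain.singleton _
  have hsr : ∀ z ∈ ([Sigma.mk i g] : List (Σ i, G i)), z.2 ∉ (φ z.1).range := by
    intro z hz; rw [List.mem_singleton] at hz; subst hz; exact hg
  have hy : ∀ L : List (Σ i, G i), L.IsChain (fun a b => a.1 ≠ b.1) →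
      (∀ x ∈ L, x.2 ∉ (φ x.1).range) → ℓπ[φ] L = of i g → 2 ≤ L.length →
      L.head?.map Sigma.fst ≠ L.getLast?.map Sigma.fst := fun L hLc hLr hval hL2 =>
    cr_of_word hφ hsc hsr (Or.inl (by simp)) L hLc hLr (by rw [hval, lprod_singleton]) hL2
  obtain ⟨c', k, -, e⟩ := exists_rotate_of_isConj_of_cr hφ hwc hwr hw2 hwcr hy h
  have hsr' : ∀ z ∈ ([Sigma.mk i ((φ i c')⁻¹ * g * φ i c')] : List (Σ i, G i)),
      z.2 ∉ (φ z.1).range := by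
    intro z hz; rw [List.mem_singleton] at hz; subst hz
    simpa using mul_not_mem_range hg c'⁻¹ c'
  have e' : ℓπ[φ] ([Sigma.mk i ((φ i c')⁻¹ * g * φ i c')] : List (Σ i, G i)) =
      base φ 1 * ℓπ[φ] (w.rotate k) := by
    rw [map_one, one_mul, lprod_singleton]
    dsimp only
    rw [map_mul, map_mul, map_inv, of_apply_eq_base, e]
    group
  have hlen := length_eq_of_lprod_eq hφ (List.IsChain.singleton _) hsr' (isChain_rotate hwc hwcr k)
    (fun z hz => hwr z (List.mem_rotate.mp hz)) 1 e'
  rw [List.length_singleton, List.length_rotate] at hlen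
  omega

/-! ### Cyclically reduced conjugates of elliptic elements (Dyer's Thm. 2 (1)(2)) -/

omit [∀ i, Group (G i)] in
/-- A reduced word whose end factors differ, read off from the `head?/getLast?` form of cyclic
reducedness. [cite: MagnusKarrassSolitar1966, §4.2 Thm. 4.6] -/
theorem ends_ne_of_map_ne {L : List (Σ i, G i)}
    (h : L.head?.map Sigma.fst ≠ L.getLast?.map Sigma.fst) :
    ∀ a ∈ L.getLast?, ∀ b ∈ L.head?, a.1 ≠ b.1 := by
  intro a ha b hb hab
  apply h
  rw [Option.mem_def] at ha hb
  rw [ha, hb, Option.map_some, Option.map_some, hab]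

/-- **Dyer's Thm. 2 (2) / MKS 4.6 (ii).**  Let `g ∈ G i` be not conjugate within `G i` into
`φ i(H)` (an element of minimal length `1`).  Every cyclically reduced conjugate `y` of `of i g` is
a letter `of i g'` of the same factor with `g' ~_{G i} g` (*"if `‖x‖ = 1`, then `‖y‖ = 1` and either
`x ∈ A`, `y ∈ A` and `x ~_A y`, or else `x ∈ B`, `y ∈ B` and `x ~_B y`"*).
[cite: Dyer1980, Thm. 2 (2) p.38] -/
theorem exists_eq_of_of_isConj_of_cr (hφ : ∀ i, Function.Injective (φ i)) {i : ι} {g : G i}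
    (hg : ∀ a : G i, a * g * a⁻¹ ∉ (φ i).range) {y : PushoutI φ}
    (hy : ∀ L : List (Σ i, G i), L.IsChain (fun a b => a.1 ≠ b.1) →
      (∀ x ∈ L, x.2 ∉ (φ x.1).range) → ℓπ[φ] L = y → 2 ≤ L.length →
      L.head?.map Sigma.fst ≠ L.getLast?.map Sigma.fst)
    (h : IsConj (of (φ := φ) i g) y) : ∃ g' : G i, IsConj g g' ∧ y = of i g' := by
  obtain ⟨c₀, l, hlc, hlr, rfl⟩ := exists_reduced_eq hφ y
  rcases l with _ | ⟨⟨j, a⟩, _ | ⟨b, u⟩⟩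
  · exact absurd (by simpa using h) (not_isConj_of_base hφ hg c₀)
  · have e : base φ c₀ * ℓπ[φ] ([⟨j, a⟩] : List (Σ i, G i)) = of j (φ j c₀ * a) := by
      rw [lprod_singleton, map_mul, of_apply_eq_base]
    rw [e] at h ⊢
    by_cases hji : j = i
    · subst j
      exact ⟨φ i c₀ * a, (isConj_of_of_iff hφ hg).1 h, rfl⟩
    · exact absurd h (not_isConj_of_of hφ (Ne.symm hji) hg _)
  · exfalso
    -- the word with `c₀` absorbed into the first letter is cyclically reduced of length `≥ 2`
    have hval : ℓπ[φ] (⟨j, φ j c₀ * a⟩ :: b :: u) = base φ c₀ * ℓπ[φ] (⟨j, a⟩ :: b :: u) :=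
      (base_mul_lprod_cons c₀ j a (b :: u)).symm
    have hLc : (⟨j, φ j c₀ * a⟩ :: b :: u : List (Σ i, G i)).IsChain (fun a b => a.1 ≠ b.1) :=
      isChain_of_map_fst_eq (by simp) hlc
    have hLr : ∀ z ∈ (⟨j, φ j c₀ * a⟩ :: b :: u : List (Σ i, G i)), z.2 ∉ (φ z.1).range := by
      intro z hz
      rw [List.mem_cons] at hz
      rcases hz with rfl | hz
      · exact base_mul_not_mem_range (hlr _ List.mem_cons_self) c₀
      · exact hlr z (List.mem_cons_of_mem _ hz)
    have hLcr := ends_ne_of_map_ne (hy _ hLc hLr hval (by simp))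
    rw [← hval] at h
    exact not_isConj_lprod_of hφ hLc hLr (by simp) hLcr g h.symm

/-- **Dyer's Thm. 2 (1) / MKS 4.6 (i).**  Every cyclically reduced conjugate `y` of a base element
`base c` lies in a factor: `y = of i g` with `g` conjugate within `G i` to some `φ i c'` and `c'`
joined to `c` by a chain of elements of `H`, consecutive terms conjugate in a factor (*"if
`‖x‖ = 0`, then `‖y‖ ≤ 1` and if `y ∈ A` say, there is a sequence `h₁, h₂, …, h_r` of elements in
`H` such that `y ~_A h₁ ~_B h₂ ~_A ⋯ ~ h_r = x`"*). [cite: Dyer1980, Thm. 2 (1) p.37–38] -/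
theorem exists_eq_of_of_isConj_base_of_cr [Nonempty ι] (hφ : ∀ i, Function.Injective (φ i))
    {c : H} {y : PushoutI φ}
    (hy : ∀ L : List (Σ i, G i), L.IsChain (fun a b => a.1 ≠ b.1) →
      (∀ x ∈ L, x.2 ∉ (φ x.1).range) → ℓπ[φ] L = y → 2 ≤ L.length →
      L.head?.map Sigma.fst ≠ L.getLast?.map Sigma.fst)
    (h : IsConj (base φ c) y) :
    ∃ (i : ι) (g : G i) (c' : H), y = of i g ∧ IsConj g (φ i c') ∧
      Relation.ReflTransGen (fun c c' : H => ∃ i, IsConj (φ i c) (φ i c')) c' c := by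
  obtain ⟨c₀, l, hlc, hlr, rfl⟩ := exists_reduced_eq hφ y
  rcases l with _ | ⟨⟨j, a⟩, _ | ⟨b, u⟩⟩
  · obtain ⟨i₀⟩ := ‹Nonempty ι›
    have e : base φ c₀ * ℓπ[φ] ([] : List (Σ i, G i)) = of i₀ (φ i₀ c₀) := by
      rw [of_apply_eq_base]; simp
    refine ⟨i₀, φ i₀ c₀, c₀, e, IsConj.refl _, reflTransGen_factorConj_symm ?_⟩
    exact (isConj_base_iff_reflTransGen hφ).1 (by simpa using h)
  · have e : base φ c₀ * ℓπ[φ] ([⟨j, a⟩] : List (Σ i, G i)) = of j (φ j c₀ * a) := by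
      rw [lprod_singleton, map_mul, of_apply_eq_base]
    rw [e] at h
    obtain ⟨c', hc', hch⟩ := (isConj_of_base_iff hφ).1 h.symm
    exact ⟨j, φ j c₀ * a, c', e, hc', hch⟩
  · exfalso
    have hval : ℓπ[φ] (⟨j, φ j c₀ * a⟩ :: b :: u) = base φ c₀ * ℓπ[φ] (⟨j, a⟩ :: b :: u) :=
      (base_mul_lprod_cons c₀ j a (b :: u)).symm
    have hLc : (⟨j, φ j c₀ * a⟩ :: b :: u : List (Σ i, G i)).IsChain (fun a b => a.1 ≠ b.1) :=
      isChain_of_map_fst_eq (by simp) hlc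
    have hLr : ∀ z ∈ (⟨j, φ j c₀ * a⟩ :: b :: u : List (Σ i, G i)), z.2 ∉ (φ z.1).range := by
      intro z hz
      rw [List.mem_cons] at hz
      rcases hz with rfl | hz
      · exact base_mul_not_mem_range (hlr _ List.mem_cons_self) c₀
      · exact hlr z (List.mem_cons_of_mem _ hz)
    have hLcr := ends_ne_of_map_ne (hy _ hLc hLr hval (by simp))
    rw [← hval] at h
    exact not_isConj_lprod_base hφ hLc hLr (by simp) hLcr c h.symm

/-! ### Malnormal amalgamated subgroups: the chains collapse -/

/-- Under malnormality of `φ i(H)` in `G i`, elements of `H` conjugate in `G i` are conjugate in `H`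
(a conjugator off `φ i(H)` forces both to be trivial). [cite: MagnusKarrassSolitar1966, §4.2 Cor. 4.5] -/
theorem isConj_of_isConj_apply_of_malnormal (hφ : ∀ i, Function.Injective (φ i)) {i : ι}
    (hmal : ∀ g : G i, g ∉ (φ i).range → ∀ c : H, g * φ i c * g⁻¹ ∈ (φ i).range → c = 1)
    {c c' : H} (h : IsConj (φ i c) (φ i c')) : IsConj c c' := by
  obtain ⟨a, ha⟩ := isConj_iff.1 h
  by_cases har : a ∈ (φ i).range
  · obtain ⟨d, rfl⟩ := har
    refine isConj_iff.2 ⟨d, hφ i ?_⟩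
    rw [map_mul, map_mul, map_inv, ha]
  · have hc : c = 1 := hmal a har c (by rw [ha]; exact ⟨c', rfl⟩)
    subst hc
    have hc' : c' = 1 := hφ i (by rw [← ha, map_one]; group)
    subst hc'
    exact IsConj.refl _

/-- Under malnormality in every factor, a chain through the base group joins only `H`-conjugate
elements. [cite: MagnusKarrassSolitar1966, §4.2 Cor. 4.5] -/
theorem isConj_of_reflTransGen_of_malnormal (hφ : ∀ i, Function.Injective (φ i))
    (hmal : ∀ (i : ι) (g : G i), g ∉ (φ i).range → ∀ c : H, g * φ i c * g⁻¹ ∈ (φ i).range → c = 1)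
    {c c' : H} (h : Relation.ReflTransGen (fun c c' : H => ∃ i, IsConj (φ i c) (φ i c')) c c') :
    IsConj c c' := by
  induction h with
  | refl => exact IsConj.refl _
  | tail _ hbc ih =>
    obtain ⟨i, hi⟩ := hbc
    exact ih.trans (isConj_of_isConj_apply_of_malnormal hφ (hmal i) hi)

/-- **Base elements of an amalgam with malnormal amalgamated subgroup are conjugate iff they are
conjugate in `H`.** [cite: MagnusKarrassSolitar1966, §4.2 Thm. 4.6] -/
theorem isConj_base_iff_of_malnormal [Nonempty ι] (hφ : ∀ i, Function.Injective (φ i))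
    (hmal : ∀ (i : ι) (g : G i), g ∉ (φ i).range → ∀ c : H, g * φ i c * g⁻¹ ∈ (φ i).range → c = 1)
    {c c' : H} : IsConj (base φ c) (base φ c') ↔ IsConj c c' :=
  ⟨fun h => isConj_of_reflTransGen_of_malnormal hφ hmal ((isConj_base_iff_reflTransGen hφ).1 h),
    (base φ).map_isConj⟩

/-- **For commutative `H` malnormal in every factor, base elements are conjugate in the amalgam iff
they are equal** (e.g. `c ^ r ~ c ^ s ↔ r = s` in the surface amalgam `F_{2g} *_ℤ F_{2h}`).
[cite: MagnusKarrassSolitar1966, §4.2 Thm. 4.6] -/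
theorem base_isConj_base_iff_eq_of_malnormal [Nonempty ι] (hφ : ∀ i, Function.Injective (φ i))
    (hmal : ∀ (i : ι) (g : G i), g ∉ (φ i).range → ∀ c : H, g * φ i c * g⁻¹ ∈ (φ i).range → c = 1)
    (hcomm : ∀ a b : H, a * b = b * a) {c c' : H} : IsConj (base φ c) (base φ c') ↔ c = c' := by
  rw [isConj_base_iff_of_malnormal hφ hmal, isConj_iff]
  constructor
  · rintro ⟨d, rfl⟩
    rw [hcomm d c, mul_inv_cancel_right]
  · rintro rfl
    exact ⟨1, by simp⟩

/-- **A letter versus a base element, malnormal case.**  For `g ∈ G i`, `of i g ~ base c'` in the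
amalgam iff `g ~_{G i} φ i c` for some `c` conjugate to `c'` in `H`.
[cite: MagnusKarrassSolitar1966, §4.2 Thm. 4.6] -/
theorem isConj_of_base_iff_of_malnormal (hφ : ∀ i, Function.Injective (φ i))
    (hmal : ∀ (i : ι) (g : G i), g ∉ (φ i).range → ∀ c : H, g * φ i c * g⁻¹ ∈ (φ i).range → c = 1)
    {i : ι} {g : G i} {c' : H} :
    IsConj (of (φ := φ) i g) (base φ c') ↔ ∃ c : H, IsConj g (φ i c) ∧ IsConj c c' := by
  rw [isConj_of_base_iff hφ]
  constructor
  · rintro ⟨c, hgc, hch⟩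
    exact ⟨c, hgc, isConj_of_reflTransGen_of_malnormal hφ hmal hch⟩
  · rintro ⟨c, hgc, hcc⟩
    obtain ⟨d, rfl⟩ := isConj_iff.1 hcc
    exact ⟨c, hgc, Relation.ReflTransGen.single ⟨i, (φ i).map_isConj (isConj_iff.2 ⟨d, rfl⟩)⟩⟩

end Amalgam

end Literature.GroupTheory.CombinatorialGroupTheory
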